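import Summits.CriticalPhenomena.PercolationContinuityZ3.Theorems.Transplant.SkelFrmQuasiBParamsFaceCountsA
import Summits.CriticalPhenomena.PercolationContinuityZ3.Theorems.Transplant.SkelFrmBParamsFaceCountsA
import Summits.CriticalPhenomena.PercolationContinuityZ3.Theorems.Transplant.SkelNegBParamsFaceCountsShiftA
import Summits.CriticalPhenomena.PercolationContinuityZ3.Theorems.Transplant.PlanarSkeletonFrmQuasiDefs
import Summits.CriticalPhenomena.PercolationContinuityZ3.Theorems.Transplant.PlanarSkeletonFrmDefs
import Summits.CriticalPhenomena.PercolationContinuityZ3.Theorems.Transplant.SkelPhiStepIDataNS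
import Summits.CriticalPhenomena.PercolationContinuityZ3.Theorems.Transplant.SkelFrmQuasi1ParamsLBL
import Summits.CriticalPhenomena.PercolationContinuityZ3.Theorems.Transplant.SkelFrmQuasiBParamsFaceUnits
import Summits.CriticalPhenomena.PercolationContinuityZ3.Theorems.Transplant.SkelFrmQuasiBParamsLF
import Summits.CriticalPhenomena.PercolationContinuityZ3.Theorems.Transplant.SkelFrmQuasiBParamsLFA
import HarnessLib
import Summits.CriticalPhenomena.PercolationContinuityZ3.Theorems.Transplant.SkelFrmBParamsFaceCountsShiftA
/-!
# GEN-Q PORT (WAVE-Q table v0.8 section 2, row G042, U-level L8; captain R-6/R-7 2026-08-27: carrier token swap `PlanarSkeletonFrmFrom ↦ PlanarSkeletonFrmQuasi`)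
# of the tree module «Transplant/SkelFrmFromBParamsFaceCountsShiftA» (sha256 9f4c6094a91c0ceb…) onto the quasi-step carrier `PlanarSkeletonFrmQuasi` (p507026): «SkelFrmQuasiBParamsFaceCountsShiftA»

ORIGINAL TITLE: (F) VALUE LAYER, N2 twin (hp-8 g42, 2026-08-23; F-DISCHARGE-MAP-N2 G18): `port_frm.py` text of N1 `SkelNegBParamsFaceCountsShiftA` (p3-g12) over

builds on p205010 (kernel theorem, internal audit signed; external expert review pending) — nothing in this file uses p205010; NOTHING is claimed about any open node
((N3-b), the end state).  Lane `prim-bschramm`, seat `prim-bschramm-stmt` (gen 33; GEN-Q column pen; tool = captain gen-1 g4's port_genq.py R-14 --cone + p3-g30's T1 patch).  Helper file (`--supports stmt-CriticalPhenomena-4575 --as helper`).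
PORT RULES (U-wave r1–r4 re-used, GEN-Q hunk classes of p3-g29 #6136): declaration order, names and proof texts are those of «SkelFrmFromBParamsFaceCountsShiftA», byte-identical except
(i) the carrier token `PlanarSkeletonFrmFrom ↦ PlanarSkeletonFrmQuasi` in binders, `namespace`/`end` lines and qualified names (module names `SkelFrmFrom… ↦ SkelFrmQuasi…`
in imports of already-ported rows); (ii) `Φ.step ↦ Φ.qstep` with the called Steps lemma replaced by its `…Q`/`_q` twin and the cost `Φ.M` threaded (none in this file unless
listed below); (iii) `Φ.cyl_connected ↦ Φ.cyl_reach` readers (none unless listed); (iv) graph-ball radii / window floors ×`Φ.M` (none unless listed).  Carrier-free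
residents stay imported/exported from the original «SkelFrmBParamsFaceCountsShiftA» exactly as in the FrmFrom port.  Docstrings and citations are the original's.

-/

noncomputable section

open scoped Classical

namespace Summit.CriticalPhenomena.PercolationContinuityZ3.Theorems.Transplant

namespace PlanarSkeletonFrmQuasi

namespace NegB

open Literature.Probability.Percolation Literature.Probability.LatticeModels SimpleGraph
open Literature.Probability.Percolation.KozmaNitzan.Cells (oth sgOf sgOf_sign)
open SkelConc (Consts)
open Skelφ.StepI (DataN)
open TwoAxis.Para (modulus)
open Neg

namespace KS

section Shift

/-- The cross shift moves `Λ₀` by `v_β·(σT·v_L) − v_L·((σT·h_L·v_L)/n_L)`. [folklore] -/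
theorem Λ₀of_yTX0 (κ : Consts) {V : Type} [DecidableEq V] [Countable V] {G : SimpleGraph V} [G.LocallyFinite] (Φ : PlanarSkeletonFrmQuasi G) (t : V) (p : unitInterval) (D : Skelφ.StepI.DataNS V) (g : ℕ) (f : ℕ) (yL : Site 2) (σT : ℤ) :
    Λ₀of κ Φ t p D g f (yTX0 κ Φ t p D g f yL σT) - Λ₀of κ Φ t p D g f yL =
      vβL κ Φ t p D g f * (σT * vL κ Φ t p D g f) - vL κ Φ t p D g f * (σT * hL κ Φ t p D g f * vL κ Φ t p D g f / (nL κ Φ t p D g f : ℤ)) := by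
  unfold Λ₀of yTX0 vβL
  simp only [Pi.add_apply, Skelφ.pt_zero, Skelφ.pt_one]
  ring

/-- The cross shift moves `Λ₁` by `n_L·((σT·h_L·v_L)/n_L) − h_L·(σT·v_L)` (minus a remainder). [folklore] -/
theorem Λ₁of_yTX0 (κ : Consts) {V : Type} [DecidableEq V] [Countable V] {G : SimpleGraph V} [G.LocallyFinite] (Φ : PlanarSkeletonFrmQuasi G) (t : V) (p : unitInterval) (D : Skelφ.StepI.DataNS V) (g : ℕ) (f : ℕ) (yL : Site 2) (σT : ℤ) :
    Λ₁of κ Φ t p D g f (yTX0 κ Φ t p D g f yL σT) - Λ₁of κ Φ t p D g f yL =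
      (nL κ Φ t p D g f : ℤ) * (σT * hL κ Φ t p D g f * vL κ Φ t p D g f / (nL κ Φ t p D g f : ℤ)) - hL κ Φ t p D g f * (σT * vL κ Φ t p D g f) := by
  unfold Λ₁of yTX0
  simp only [Pi.add_apply, Skelφ.pt_zero, Skelφ.pt_one]
  ring

/-- **`u₀·L̂₀ ≤ m`** (`s₀ = ⌊m/L̂₀⌋ − 1`, `L̂₀ = |v_β| + |v_L| ≥ 1`); also `|v_L| ≤ L̂₀`. [folklore] -/
theorem u₀_mul_L0hat_le (κ : Consts) {V : Type} [DecidableEq V] [Countable V] {G : SimpleGraph V} [G.LocallyFinite] (Φ : PlanarSkeletonFrmQuasi G) (t : V) (p : unitInterval) (D : Skelφ.StepI.DataNS V) (g : ℕ) (f : ℕ) (hN : EqNumL κ Φ t p D g f) :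
    u₀A κ Φ t p D g f * (|vβL κ Φ t p D g f| + |vL κ Φ t p D g f|) ≤ modulus (nL κ Φ t p D g f) (hL κ Φ t p D g f) (vL κ Φ t p D g f) (vβL κ Φ t p D g f) ∧
      0 ≤ u₀A κ Φ t p D g f := by
  obtain ⟨hn1, hℓ1⟩ := one_le_of_eqNumL κ Φ t p D g f hN
  have hL0 : (1 : ℤ) ≤ |vβL κ Φ t p D g f| + |vL κ Φ t p D g f| := one_le_L0 hn1 hℓ1 _ _
  have hm : 0 < modulus (nL κ Φ t p D g f) (hL κ Φ t p D g f) (vL κ Φ t p D g f) (vβL κ Φ t p D g f) := Skelφ.NegPrm.modulus_vβOf_pos hn1 hℓ1 _ _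
  have hu : u₀A κ Φ t p D g f = fm0A κ Φ t p D g f := by unfold u₀A; exact (fcellsA_s_at κ Φ t p D g f hN).1
  have hu1 : 1 ≤ u₀A κ Φ t p D g f := (units_eqA κ Φ t p D g f).2.2.2.2.1
  have e : fm0A κ Φ t p D g f = modulus (nL κ Φ t p D g f) (hL κ Φ t p D g f) (vL κ Φ t p D g f) (vβL κ Φ t p D g f) / (|vβL κ Φ t p D g f| + |vL κ Φ t p D g f|) - 1 := by
    unfold fm0A; rw [(mA_eq κ Φ t p D g f).1]; rfl
  refine ⟨?_, by linarith⟩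
  rw [hu, e]
  have h1 := Int.mul_ediv_self_le (x := modulus (nL κ Φ t p D g f) (hL κ Φ t p D g f) (vL κ Φ t p D g f) (vβL κ Φ t p D g f))
    (k := |vβL κ Φ t p D g f| + |vL κ Φ t p D g f|) (by linarith)
  nlinarith

/-- **`u₁·n_L ≤ m`** (`s₁ = ⌊m/L̂₁⌋ − 1`, `L̂₁ = n_L + |h_L|`). [folklore] -/
theorem u₁_mul_nL_le (κ : Consts) {V : Type} [DecidableEq V] [Countable V] {G : SimpleGraph V} [G.LocallyFinite] (Φ : PlanarSkeletonFrmQuasi G) (t : V) (p : unitInterval) (D : Skelφ.StepI.DataNS V) (g : ℕ) (f : ℕ) (hN : EqNumL κ Φ t p D g f) :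
    u₁A κ Φ t p D g f * (nL κ Φ t p D g f : ℤ) ≤ modulus (nL κ Φ t p D g f) (hL κ Φ t p D g f) (vL κ Φ t p D g f) (vβL κ Φ t p D g f) ∧
      0 ≤ u₁A κ Φ t p D g f := by
  obtain ⟨hn1, hℓ1⟩ := one_le_of_eqNumL κ Φ t p D g f hN
  have hn1' : (1 : ℤ) ≤ nL κ Φ t p D g f := by exact_mod_cast hn1
  have hm : 0 < modulus (nL κ Φ t p D g f) (hL κ Φ t p D g f) (vL κ Φ t p D g f) (vβL κ Φ t p D g f) := Skelφ.NegPrm.modulus_vβOf_pos hn1 hℓ1 _ _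
  have hu : u₁A κ Φ t p D g f = fm1A κ Φ t p D g f := by unfold u₁A; exact (fcellsA_s_at κ Φ t p D g f hN).2
  have hu1 : 1 ≤ u₁A κ Φ t p D g f := (units_eqA κ Φ t p D g f).2.2.2.2.2
  have e : fm1A κ Φ t p D g f = modulus (nL κ Φ t p D g f) (hL κ Φ t p D g f) (vL κ Φ t p D g f) (vβL κ Φ t p D g f) / ((nL κ Φ t p D g f : ℤ) + |hL κ Φ t p D g f|) - 1 := by
    unfold fm1A; rw [(mA_eq κ Φ t p D g f).2]; rfl
  refine ⟨?_, by linarith⟩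
  rw [hu, e]
  have ha : 0 ≤ |hL κ Φ t p D g f| := abs_nonneg _
  have hL1 : (1 : ℤ) ≤ (nL κ Φ t p D g f : ℤ) + |hL κ Φ t p D g f| := by linarith
  set m := modulus (nL κ Φ t p D g f) (hL κ Φ t p D g f) (vL κ Φ t p D g f) (vβL κ Φ t p D g f)
  set L := (nL κ Φ t p D g f : ℤ) + |hL κ Φ t p D g f|
  have h1 : L * (m / L) ≤ m := Int.mul_ediv_self_le (by linarith)
  have h2 : 0 ≤ m / L := Int.ediv_nonneg hm.le (by linarith)
  nlinarith

export PlanarSkeletonNeg.NegB.KS (ediv_sub_ediv_abs_le)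

/-- **THE CROSS SHIFT MOVES THE ALONG READING BY AT MOST `u₀ + 2`** (`σT = ±1`). [folklore] -/
theorem FcA_yTX0_sub_abs_le (κ : Consts) {V : Type} [DecidableEq V] [Countable V] {G : SimpleGraph V} [G.LocallyFinite] (Φ : PlanarSkeletonFrmQuasi G) (t : V) (p : unitInterval) (D : Skelφ.StepI.DataNS V) (g : ℕ) (f : ℕ) (hN : EqNumL κ Φ t p D g f) (yL : Site 2) {σT : ℤ} (hσT : σT = 1 ∨ σT = -1) :
    |FcA κ Φ t p D g f (yTX0 κ Φ t p D g f yL σT) - FcA κ Φ t p D g f yL| ≤ u₀A κ Φ t p D g f + 2 := by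
  obtain ⟨hn1, hℓ1⟩ := one_le_of_eqNumL κ Φ t p D g f hN
  have hn0 : (0 : ℤ) < nL κ Φ t p D g f := by exact_mod_cast hn1
  have hm : 0 < modulus (nL κ Φ t p D g f) (hL κ Φ t p D g f) (vL κ Φ t p D g f) (vβL κ Φ t p D g f) := Skelφ.NegPrm.modulus_vβOf_pos hn1 hℓ1 _ _
  obtain ⟨huL, hu0⟩ := u₀_mul_L0hat_le κ Φ t p D g f hN
  have hv := hN.v_le
  rw [FcA_eq, FcA_eq]
  set m := modulus (nL κ Φ t p D g f) (hL κ Φ t p D g f) (vL κ Φ t p D g f) (vβL κ Φ t p D g f) with hmdef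
  set u := u₀A κ Φ t p D g f
  set n : ℤ := (nL κ Φ t p D g f : ℤ)
  set v := vL κ Φ t p D g f
  set h := hL κ Φ t p D g f
  set vβ := vβL κ Φ t p D g f
  have hΔ := Λ₀of_yTX0 κ Φ t p D g f yL σT
  set Λ' := Λ₀of κ Φ t p D g f (yTX0 κ Φ t p D g f yL σT)
  set Λ := Λ₀of κ Φ t p D g f yL
  -- `q' := (σT·h·v)/n`, `n·q' = σT·h·v − r'`, `0 ≤ r' < n`; then `n·ΔΛ₀ = σT·v·m + v·r'`
  obtain ⟨q1, q2⟩ := PlanarSkeletonNeg.NegB.RootArith.floor_sandwich (x := σT * h * v) (d := n) hn0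
  set q' := σT * h * v / n
  have hσsq : σT * σT = 1 := by rcases hσT with hs | hs <;> simp [hs]
  have hnΔ : n * (vβ * (σT * v) - v * q') = σT * v * m + v * (σT * h * v - n * q') := by
    rw [hmdef]; unfold TwoAxis.Para.modulus; ring
  obtain ⟨hv1, hv2⟩ := abs_le.1 hv
  -- `u·|ΔΛ₀| ≤ u·m + m`
  have key : u * |vβ * (σT * v) - v * q'| ≤ u * m + m := by
    have hv0 : 0 ≤ |v| := abs_nonneg v
    have hr0 : 0 ≤ σT * h * v - n * q' := by linarith
    have hr1 : σT * h * v - n * q' < n := by linarith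
    -- `n·|ΔΛ₀| ≤ |v|·m + |v|·r' ≤ |v|·m + |v|·n`
    have h3 : n * |vβ * (σT * v) - v * q'| ≤ |v| * m + |v| * n := by
      have e1 : n * |vβ * (σT * v) - v * q'| = |n * (vβ * (σT * v) - v * q')| := by
        rw [abs_mul, abs_of_pos hn0]
      rw [e1, hnΔ]
      calc |σT * v * m + v * (σT * h * v - n * q')| ≤ |σT * v * m| + |v * (σT * h * v - n * q')| := abs_add_le _ _
        _ = |v| * m + |v| * (σT * h * v - n * q') := by
            rw [abs_mul, abs_mul, abs_mul, abs_of_pos hm, abs_of_nonneg hr0]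
            rcases hσT with hs | hs <;> simp [hs]
        _ ≤ |v| * m + |v| * n := by nlinarith
    -- multiply the target by `n`: `n·(u·|Δ|) ≤ u·(|v|m + |v|n) ≤ n·u·m + n·m`
    have h4 : n * (u * |vβ * (σT * v) - v * q'|) ≤ u * (|v| * m + |v| * n) := by nlinarith
    have h5 : u * |v| ≤ m := le_trans (by nlinarith [abs_nonneg vβ]) huL
    have h6a : u * |v| * m ≤ u * n * m := mul_le_mul_of_nonneg_right (mul_le_mul_of_nonneg_left hv hu0) hm.le
    have h6b : u * |v| * n ≤ m * n := mul_le_mul_of_nonneg_right h5 hn0.le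
    have h6 : u * (|v| * m + |v| * n) ≤ n * (u * m) + n * m := by nlinarith
    exact le_of_mul_le_mul_left (by linarith) hn0
  have hX : |(2 * u * Λ' + m) - (2 * u * Λ + m)| ≤ (u + 1) * (2 * m) := by
    have e1 : (2 * u * Λ' + m) - (2 * u * Λ + m) = 2 * (u * (Λ' - Λ)) := by ring
    rw [e1, hΔ, abs_mul, abs_of_pos (by norm_num : (0:ℤ) < 2), abs_mul, abs_of_nonneg hu0]
    nlinarith
  have := ediv_sub_ediv_abs_le (by linarith : (0:ℤ) < 2 * m) hX
  linarith

/-- **THE CROSS SHIFT MOVES THE ORDINATE READING BY AT MOST `2`** (any `σT`). [folklore] -/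
theorem F1cA_yTX0_sub_abs_le (κ : Consts) {V : Type} [DecidableEq V] [Countable V] {G : SimpleGraph V} [G.LocallyFinite] (Φ : PlanarSkeletonFrmQuasi G) (t : V) (p : unitInterval) (D : Skelφ.StepI.DataNS V) (g : ℕ) (f : ℕ) (hN : EqNumL κ Φ t p D g f) (yL : Site 2) (σT : ℤ) :
    |F1cA κ Φ t p D g f (yTX0 κ Φ t p D g f yL σT) - F1cA κ Φ t p D g f yL| ≤ 2 := by
  obtain ⟨hn1, hℓ1⟩ := one_le_of_eqNumL κ Φ t p D g f hN
  have hn0 : (0 : ℤ) < nL κ Φ t p D g f := by exact_mod_cast hn1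
  have hm : 0 < modulus (nL κ Φ t p D g f) (hL κ Φ t p D g f) (vL κ Φ t p D g f) (vβL κ Φ t p D g f) := Skelφ.NegPrm.modulus_vβOf_pos hn1 hℓ1 _ _
  obtain ⟨hun, hu0⟩ := u₁_mul_nL_le κ Φ t p D g f hN
  rw [F1cA_eq, F1cA_eq]
  set m := modulus (nL κ Φ t p D g f) (hL κ Φ t p D g f) (vL κ Φ t p D g f) (vβL κ Φ t p D g f)
  set u := u₁A κ Φ t p D g f
  set n : ℤ := (nL κ Φ t p D g f : ℤ)
  set v := vL κ Φ t p D g f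
  set h := hL κ Φ t p D g f
  have hΔ := Λ₁of_yTX0 κ Φ t p D g f yL σT
  set Λ' := Λ₁of κ Φ t p D g f (yTX0 κ Φ t p D g f yL σT)
  set Λ := Λ₁of κ Φ t p D g f yL
  obtain ⟨q1, q2⟩ := PlanarSkeletonNeg.NegB.RootArith.floor_sandwich (x := σT * h * v) (d := n) hn0
  have hr : |n * (σT * h * v / n) - h * (σT * v)| ≤ n := by
    have e : h * (σT * v) = σT * h * v := by ring
    rw [e, abs_le]; constructor <;> linarith
  have hX : |(2 * u * Λ' + m) - (2 * u * Λ + m)| ≤ 1 * (2 * m) := by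
    have e1 : (2 * u * Λ' + m) - (2 * u * Λ + m) = 2 * (u * (Λ' - Λ)) := by ring
    rw [e1, hΔ, abs_mul, abs_of_pos (by norm_num : (0:ℤ) < 2), abs_mul, abs_of_nonneg hu0]
    nlinarith [abs_nonneg (n * (σT * h * v / n) - h * (σT * v))]
  have := ediv_sub_ediv_abs_le (by linarith : (0:ℤ) < 2 * m) hX
  linarith [abs_le.1 this]

/-- `u`-strides do not move the ordinate reading: `F1cA (y + k·(n_L, h_L)) = F1cA y`. [folklore] -/
theorem F1cA_add_stride (κ : Consts) {V : Type} [DecidableEq V] [Countable V] {G : SimpleGraph V} [G.LocallyFinite] (Φ : PlanarSkeletonFrmQuasi G) (t : V) (p : unitInterval) (D : Skelφ.StepI.DataNS V) (g : ℕ) (f : ℕ) (y : Site 2) (k : ℤ) :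
    F1cA κ Φ t p D g f (y + Skelφ.pt (k * nL κ Φ t p D g f) (k * hL κ Φ t p D g f)) = F1cA κ Φ t p D g f y := by
  have hΛ : Λ₁of κ Φ t p D g f (y + Skelφ.pt (k * nL κ Φ t p D g f) (k * hL κ Φ t p D g f)) = Λ₁of κ Φ t p D g f y := by
    unfold Λ₁of; simp only [Pi.add_apply, Skelφ.pt_zero, Skelφ.pt_one]; ring
  rw [F1cA_eq, F1cA_eq, hΛ]

/-- **The tangential origin's ordinate reading is the cross-shifted origin's**: `F1cA (yL + crossOffX … σ σT Nr) = F1cA (yTX0 yL σT)`. [folklore] -/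
theorem F1cA_crossOffX (κ : Consts) {V : Type} [DecidableEq V] [Countable V] {G : SimpleGraph V} [G.LocallyFinite] (Φ : PlanarSkeletonFrmQuasi G) (t : V) (p : unitInterval) (D : Skelφ.StepI.DataNS V) (g : ℕ) (f : ℕ) (yL : Site 2) (σ σT : ℤ) (Nr : ℕ) :
    F1cA κ Φ t p D g f (yL + Skelφ.crossOffX (nL κ Φ t p D g f) (hL κ Φ t p D g f) (vL κ Φ t p D g f) σ σT Nr) =
      F1cA κ Φ t p D g f (yTX0 κ Φ t p D g f yL σT) := by
  rw [crossOffX_eq, F1cA_add_stride]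

/-- **THE FAR-END FACT SERVED TO G-X (`FX2`/`FX4`)**: with `Nr := NrX yL σT x du z` (target at least one stride ahead),
`σ·FcA yL + u₀·(Nr+1) ≤ 20·r₀ − lev + 2·u₀ + 2`. [cite: KozmaNitzan2024, §4 Lemma 11 (p. 22)] -/
theorem hfar_of_NrX (κ : Consts) {V : Type} [DecidableEq V] [Countable V] {G : SimpleGraph V} [G.LocallyFinite] (Φ : PlanarSkeletonFrmQuasi G) (t : V) (p : unitInterval) (D : Skelφ.StepI.DataNS V) (g : ℕ) (f : ℕ) (P : PCells2T) (hN : EqNumL κ Φ t p D g f) (yL : Site 2) {σT : ℤ} (hσT : σT = 1 ∨ σT = -1) (x : Site 2) (du : MDir) (hd : du.1 = 0) (z : Site 2)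
    (hX : u₀A κ Φ t p D g f ≤ sgOf du * (T0X P x du z - FcA κ Φ t p D g f (yTX0 κ Φ t p D g f yL σT))) :
    sgOf du * FcA κ Φ t p D g f yL + u₀A κ Φ t p D g f * ((NrX κ Φ t p D g f P yL σT x du z : ℤ) + 1) ≤
      20 * (P.r 0 : ℤ) - P.lev du x z + 2 * u₀A κ Φ t p D g f + 2 := by
  obtain ⟨-, r2⟩ := NrX_spec κ Φ t p D g f P hN yL σT x du z hX
  have hT := T0X_eq P x du hd z
  have hs := FcA_yTX0_sub_abs_le κ Φ t p D g f hN yL hσT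
  obtain ⟨s1, s2⟩ := abs_le.1 hs
  have hσ : sgOf du = 1 ∨ sgOf du = -1 := sgOf_sign du
  rw [mul_sub] at r2
  rcases hσ with h1 | h1 <;> rw [h1] at r2 hT ⊢ <;> linarith

end Shift

end KS

end NegB

end PlanarSkeletonFrmQuasi

end Summit.CriticalPhenomena.PercolationContinuityZ3.Theorems.Transplant

end
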